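import Summits.ValiantsHypothesis.ValiantsHypothesis.Theorems.BarrierLeverPartitionMinorsChowIntegerCertificates
import Summits.ValiantsHypothesis.ValiantsHypothesis.Theorems.BarrierLeverPartitionMinorsHitByVPTwoBlockTropical

/-!
# Route BarrierLever — Chow witnesses for partition minors (item 20172, CPM): TROPICAL DEGREES —
# the max-plus / counting shadow of the partition-coefficient recursion

Helper file (`--supports stmt-ValiantsHypothesis-20172`; cell valiant-natproofs, rung V4, 𝒟-side of
door (c); seat val-np-p4 gen 11).  Closes NO item.  Part 1 of the tropical certificate for Chow
witnesses (part 2: `…ChowTropicalCertificates`).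

Take the one-parameter forms `ℓ_k = 1 + Σ_a t^{ωx k a} x_a + Σ_c t^{ωy k c} y_c` over `ℂ[t]`
(weights `ωx ωy : ℕ → Fin h → ℕ`; `tropForm`).  The partition coefficient
`ψ_m(u, w) = coeff (E u w) (∏_{k<m} ℓ_k)` (`psi`) obeys the recursion `coeff_partitionExpo_mul_affine`
with nonnegative coefficients (`psi_succ`, `psi_zero`), vanishes when `#u + #w > m`
(`psi_eq_zero_of_lt`), and otherwise (`psi_invariant`):

* `natDegree ψ_m(u,w) ≤ tropDeg m u w` — the MAX-PLUS value of assigning the variables of `u ⊔ w`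
  injectively to the first `m` forms (`tropDeg`, the max-plus shadow of the recursion);
* its coefficient at `tropDeg` is `tropLC m u w > 0` — the number of optimal assignments (`tropLC`,
  the counting shadow).

Also `coeff_det_eq_sum_of_natDegree_le` — Leibniz at the degree budget: if `natDegree (P i j) ≤ d i j`
and every permutation has `Σ_j d (σ j) j ≤ M`, the coefficient of `t^M` in `det P` is the signed sum
over the permutations attaining `M` of the products of the budget coefficients.

WHAT THIS IS NOT: bookkeeping; nothing on items 20172 / 20195 / 19717 themselves, on crux
stmt-ValiantsHypothesis-14610, or on `VP` versus `VNP`.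
-/

set_option linter.dupNamespace false

namespace Summit.ValiantsHypothesis.ValiantsHypothesis.Theorems.BarrierLever.ChowFactor

open Finset MvPolynomial
open Summit.ValiantsHypothesis.ValiantsHypothesis.Theorems.BarrierLever.TwoBlock
  (coeff_prod_of_natDegree_le_sum)

noncomputable section

variable {h : ℕ}

/-! ## 1. The coefficient of a determinant at the degree budget -/

/-- **Leibniz at the degree budget.**  If `natDegree (P i j) ≤ d i j` and every permutation has
`Σ_j d (σ j) j ≤ M`, then the coefficient of `X^M` in `det P` is the signed sum, over the permutations
attaining `M`, of the products of the budget coefficients. -/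
theorem coeff_det_eq_sum_of_natDegree_le {r : ℕ} (P : Matrix (Fin r) (Fin r) (Polynomial ℂ))
    (d : Fin r → Fin r → ℕ) (hd : ∀ i j, (P i j).natDegree ≤ d i j) (M : ℕ)
    (hM : ∀ σ : Equiv.Perm (Fin r), ∑ j, d (σ j) j ≤ M) :
    (Matrix.det P).coeff M = ∑ σ : Equiv.Perm (Fin r),
      if ∑ j, d (σ j) j = M then ((Equiv.Perm.sign σ : ℤ) : ℂ) * ∏ j, (P (σ j) j).coeff (d (σ j) j)
      else 0 := by
  classical
  rw [Matrix.det_apply', Polynomial.finsetSum_coeff]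
  refine Finset.sum_congr rfl fun σ _ => ?_
  rw [← Polynomial.C_eq_intCast, Polynomial.coeff_C_mul]
  by_cases hσ : ∑ j, d (σ j) j = M
  · rw [if_pos hσ, ← hσ, coeff_prod_of_natDegree_le_sum _ _ _ (fun j _ => hd (σ j) j)]
  · rw [if_neg hσ]
    have hlt : (∏ j, P (σ j) j).natDegree < M :=
      lt_of_le_of_lt ((Polynomial.natDegree_prod_le _ _).trans (Finset.sum_le_sum fun j _ => hd (σ j) j))
        (lt_of_le_of_ne (hM σ) hσ)
    rw [Polynomial.coeff_eq_zero_of_natDegree_lt hlt, mul_zero]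

/-! ## 2. The max-plus shadow of the coefficient recursion -/

/-- **Max-plus value**: `tropDeg ωx ωy m u w` = the maximal total weight of an injective assignment
of the variables of `u ⊔ w` to the first `m` forms (variable `x_a ↦` form `k` weighs `ωx k a`);
meaningful when `#u + #w ≤ m`. -/
def tropDeg (ωx ωy : ℕ → Fin h → ℕ) : ℕ → Finset (Fin h) → Finset (Fin h) → ℕ
  | 0, _, _ => 0
  | m + 1, u, w => max (if u.card + w.card ≤ m then tropDeg ωx ωy m u w else 0)
      (max (u.sup fun a => ωx m a + tropDeg ωx ωy m (u.erase a) w)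
        (w.sup fun c => ωy m c + tropDeg ωx ωy m u (w.erase c)))

/-- **Number of optimal assignments** (the leading coefficient): the counting shadow of the same
recursion, summing the counts of the predecessors that attain the maximum. -/
def tropLC (ωx ωy : ℕ → Fin h → ℕ) : ℕ → Finset (Fin h) → Finset (Fin h) → ℕ
  | 0, u, w => if u = ∅ ∧ w = ∅ then 1 else 0
  | m + 1, u, w =>
      (if u.card + w.card ≤ m ∧ tropDeg ωx ωy m u w = tropDeg ωx ωy (m + 1) u w
        then tropLC ωx ωy m u w else 0) +
      (∑ a ∈ u, if ωx m a + tropDeg ωx ωy m (u.erase a) w = tropDeg ωx ωy (m + 1) u w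
        then tropLC ωx ωy m (u.erase a) w else 0) +
      ∑ c ∈ w, if ωy m c + tropDeg ωx ωy m u (w.erase c) = tropDeg ωx ωy (m + 1) u w
        then tropLC ωx ωy m u (w.erase c) else 0

/-- The `k`-th one-parameter form `1 + Σ_a t^{ωx k a} x_a + Σ_c t^{ωy k c} y_c` over `ℂ[t]`. -/
def tropForm (ωx ωy : ℕ → Fin h → ℕ) (k : ℕ) : MvPolynomial (Fin (h + h)) (Polynomial ℂ) :=
  C 1 + ∑ a, C (Polynomial.X ^ ωx k a) * X (Fin.castAdd h a) +
    ∑ c, C (Polynomial.X ^ ωy k c) * X (Fin.natAdd h c)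

/-- The partition coefficient `ψ_m(u, w)` of the product of the first `m` one-parameter forms. -/
def psi (ωx ωy : ℕ → Fin h → ℕ) (m : ℕ) (u w : Finset (Fin h)) : Polynomial ℂ :=
  coeff (∑ a ∈ u, Finsupp.single (Fin.castAdd h a) 1 + ∑ c ∈ w, Finsupp.single (Fin.natAdd h c) 1)
    (∏ k ∈ Finset.range m, tropForm ωx ωy k)

/-- The recursion for `ψ`. -/
theorem psi_succ (ωx ωy : ℕ → Fin h → ℕ) (m : ℕ) (u w : Finset (Fin h)) :
    psi ωx ωy (m + 1) u w = psi ωx ωy m u w +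
      (∑ a ∈ u, Polynomial.X ^ ωx m a * psi ωx ωy m (u.erase a) w) +
      ∑ c ∈ w, Polynomial.X ^ ωy m c * psi ωx ωy m u (w.erase c) := by
  classical
  unfold psi
  rw [Finset.prod_range_succ, tropForm, coeff_partitionExpo_mul_affine, one_mul]

/-- `ψ_0(u, w) = [u = ∅ ∧ w = ∅]`. -/
theorem psi_zero (ωx ωy : ℕ → Fin h → ℕ) (u w : Finset (Fin h)) :
    psi ωx ωy 0 u w = if u = ∅ ∧ w = ∅ then 1 else 0 := by
  classical
  unfold psi
  rw [Finset.prod_range_zero, coeff_partitionExpo_one]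

/-- `ψ_m(u, w) = 0` when there are more variables than forms. -/
theorem psi_eq_zero_of_lt (ωx ωy : ℕ → Fin h → ℕ) (m : ℕ) :
    ∀ u w : Finset (Fin h), m < u.card + w.card → psi ωx ωy m u w = 0 := by
  classical
  induction m with
  | zero =>
    intro u w hm
    rw [psi_zero]
    split_ifs with huw
    · obtain ⟨rfl, rfl⟩ := huw
      simp at hm
    · rfl
  | succ m ih =>
    intro u w hm
    rw [psi_succ, ih u w (by omega)]
    rw [Finset.sum_eq_zero (fun a ha => by
      rw [ih (u.erase a) w (by rw [Finset.card_erase_of_mem ha]; omega), mul_zero]),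
      Finset.sum_eq_zero (fun c hc => by
      rw [ih u (w.erase c) (by rw [Finset.card_erase_of_mem hc]; omega), mul_zero])]
    simp

/-- **The max-plus invariant.**  When `#u + #w ≤ m`: `natDegree ψ_m(u,w) ≤ tropDeg`, its coefficient
there is `tropLC`, and `tropLC > 0`. -/
theorem psi_invariant (ωx ωy : ℕ → Fin h → ℕ) (m : ℕ) :
    ∀ u w : Finset (Fin h), u.card + w.card ≤ m →
      (psi ωx ωy m u w).natDegree ≤ tropDeg ωx ωy m u w ∧
      (psi ωx ωy m u w).coeff (tropDeg ωx ωy m u w) = (tropLC ωx ωy m u w : ℂ) ∧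
      0 < tropLC ωx ωy m u w := by
  classical
  induction m with
  | zero =>
    intro u w hm
    have hu : u = ∅ := Finset.card_eq_zero.mp (by omega)
    have hw : w = ∅ := Finset.card_eq_zero.mp (by omega)
    subst hu hw
    rw [psi_zero, tropDeg, tropLC, if_pos ⟨rfl, rfl⟩, if_pos ⟨rfl, rfl⟩]
    exact ⟨by simp, by simp, Nat.one_pos⟩
  | succ m ih =>
    intro u w hm
    -- the three groups of terms and their degree data
    set D := tropDeg ωx ωy (m + 1) u w with hD
    have hDdef : D = max (if u.card + w.card ≤ m then tropDeg ωx ωy m u w else 0)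
        (max (u.sup fun a => ωx m a + tropDeg ωx ωy m (u.erase a) w)
          (w.sup fun c => ωy m c + tropDeg ωx ωy m u (w.erase c))) := by
      rw [hD, tropDeg]
    -- term 0
    have h0deg : (psi ωx ωy m u w).natDegree ≤ D ∧
        (psi ωx ωy m u w).coeff D =
          if u.card + w.card ≤ m ∧ tropDeg ωx ωy m u w = D then (tropLC ωx ωy m u w : ℂ) else 0 := by
      by_cases hfe : u.card + w.card ≤ m
      · obtain ⟨h1, h2, -⟩ := ih u w hfe
        have hle : tropDeg ωx ωy m u w ≤ D := by
          rw [hDdef, if_pos hfe]; exact le_max_left _ _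
        refine ⟨h1.trans hle, ?_⟩
        by_cases heq : tropDeg ωx ωy m u w = D
        · rw [if_pos ⟨hfe, heq⟩, ← heq, h2]
        · rw [if_neg (fun hh => heq hh.2)]
          exact Polynomial.coeff_eq_zero_of_natDegree_lt (lt_of_le_of_lt h1 (lt_of_le_of_ne hle heq))
      · rw [psi_eq_zero_of_lt ωx ωy m u w (by omega), if_neg (fun hh => hfe hh.1)]
        simp
    -- x-terms
    have hadeg : ∀ a ∈ u, (Polynomial.X ^ ωx m a * psi ωx ωy m (u.erase a) w).natDegree ≤ D ∧
        (Polynomial.X ^ ωx m a * psi ωx ωy m (u.erase a) w).coeff D =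
          if ωx m a + tropDeg ωx ωy m (u.erase a) w = D then (tropLC ωx ωy m (u.erase a) w : ℂ)
          else 0 := by
      intro a ha
      have hua : 0 < u.card := Finset.card_pos.mpr ⟨a, ha⟩
      have hfe : (u.erase a).card + w.card ≤ m := by rw [Finset.card_erase_of_mem ha]; omega
      obtain ⟨h1, h2, -⟩ := ih (u.erase a) w hfe
      have hle : ωx m a + tropDeg ωx ωy m (u.erase a) w ≤ D := by
        rw [hDdef]
        exact le_trans (Finset.le_sup (f := fun a => ωx m a + tropDeg ωx ωy m (u.erase a) w) ha)
          (le_trans (le_max_left _ _) (le_max_right _ _))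
      have hdeg1 : (Polynomial.X ^ ωx m a * psi ωx ωy m (u.erase a) w).natDegree ≤
          ωx m a + tropDeg ωx ωy m (u.erase a) w := by
        refine (Polynomial.natDegree_mul_le).trans ?_
        rw [Polynomial.natDegree_X_pow]
        exact Nat.add_le_add_left h1 _
      refine ⟨hdeg1.trans hle, ?_⟩
      by_cases heq : ωx m a + tropDeg ωx ωy m (u.erase a) w = D
      · rw [if_pos heq, ← heq, Polynomial.coeff_X_pow_mul', if_pos (Nat.le_add_right _ _),
          Nat.add_sub_cancel_left, h2]
      · rw [if_neg heq]
        exact Polynomial.coeff_eq_zero_of_natDegree_lt (lt_of_le_of_lt hdeg1 (lt_of_le_of_ne hle heq))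
    -- y-terms
    have hcdeg : ∀ c ∈ w, (Polynomial.X ^ ωy m c * psi ωx ωy m u (w.erase c)).natDegree ≤ D ∧
        (Polynomial.X ^ ωy m c * psi ωx ωy m u (w.erase c)).coeff D =
          if ωy m c + tropDeg ωx ωy m u (w.erase c) = D then (tropLC ωx ωy m u (w.erase c) : ℂ)
          else 0 := by
      intro c hc
      have hwc : 0 < w.card := Finset.card_pos.mpr ⟨c, hc⟩
      have hfe : u.card + (w.erase c).card ≤ m := by rw [Finset.card_erase_of_mem hc]; omega
      obtain ⟨h1, h2, -⟩ := ih u (w.erase c) hfe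
      have hle : ωy m c + tropDeg ωx ωy m u (w.erase c) ≤ D := by
        rw [hDdef]
        exact le_trans (Finset.le_sup (f := fun c => ωy m c + tropDeg ωx ωy m u (w.erase c)) hc)
          (le_trans (le_max_right _ _) (le_max_right _ _))
      have hdeg1 : (Polynomial.X ^ ωy m c * psi ωx ωy m u (w.erase c)).natDegree ≤
          ωy m c + tropDeg ωx ωy m u (w.erase c) := by
        refine (Polynomial.natDegree_mul_le).trans ?_
        rw [Polynomial.natDegree_X_pow]
        exact Nat.add_le_add_left h1 _
      refine ⟨hdeg1.trans hle, ?_⟩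
      by_cases heq : ωy m c + tropDeg ωx ωy m u (w.erase c) = D
      · rw [if_pos heq, ← heq, Polynomial.coeff_X_pow_mul', if_pos (Nat.le_add_right _ _),
          Nat.add_sub_cancel_left, h2]
      · rw [if_neg heq]
        exact Polynomial.coeff_eq_zero_of_natDegree_lt (lt_of_le_of_lt hdeg1 (lt_of_le_of_ne hle heq))
    -- assemble: degree bound
    have hdegsum : (psi ωx ωy (m + 1) u w).natDegree ≤ D := by
      rw [psi_succ]
      refine (Polynomial.natDegree_add_le _ _).trans (max_le ((Polynomial.natDegree_add_le _ _).trans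
        (max_le h0deg.1 ?_)) ?_)
      · exact Polynomial.natDegree_sum_le_of_forall_le _ _ fun a ha => (hadeg a ha).1
      · exact Polynomial.natDegree_sum_le_of_forall_le _ _ fun c hc => (hcdeg c hc).1
    -- assemble: the coefficient at D
    have hcoeff : (psi ωx ωy (m + 1) u w).coeff D = (tropLC ωx ωy (m + 1) u w : ℂ) := by
      rw [psi_succ, Polynomial.coeff_add, Polynomial.coeff_add, Polynomial.finsetSum_coeff,
        Polynomial.finsetSum_coeff, h0deg.2, Finset.sum_congr rfl (fun a ha => (hadeg a ha).2),
        Finset.sum_congr rfl (fun c hc => (hcdeg c hc).2), tropLC]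
      push_cast
      rfl
    -- assemble: positivity (some predecessor attains the maximum)
    have hpos : 0 < tropLC ωx ωy (m + 1) u w := by
      rw [tropLC]
      set Sx := u.sup fun a => ωx m a + tropDeg ωx ωy m (u.erase a) w with hSx
      set Sy := w.sup fun c => ωy m c + tropDeg ωx ωy m u (w.erase c) with hSy
      -- each group is positive as soon as one of its members attains `D`
      have gx : ∀ a ∈ u, ωx m a + tropDeg ωx ωy m (u.erase a) w = D →
          0 < ∑ a ∈ u, (if ωx m a + tropDeg ωx ωy m (u.erase a) w = D
            then tropLC ωx ωy m (u.erase a) w else 0) := by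
        intro a ha hDa
        have hua : 0 < u.card := Finset.card_pos.mpr ⟨a, ha⟩
        have hfe : (u.erase a).card + w.card ≤ m := by rw [Finset.card_erase_of_mem ha]; omega
        refine Finset.sum_pos' (fun _ _ => Nat.zero_le _) ⟨a, ha, ?_⟩
        rw [if_pos hDa]
        exact (ih (u.erase a) w hfe).2.2
      have gy : ∀ c ∈ w, ωy m c + tropDeg ωx ωy m u (w.erase c) = D →
          0 < ∑ c ∈ w, (if ωy m c + tropDeg ωx ωy m u (w.erase c) = D
            then tropLC ωx ωy m u (w.erase c) else 0) := by
        intro c hc hDc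
        have hwc : 0 < w.card := Finset.card_pos.mpr ⟨c, hc⟩
        have hfe : u.card + (w.erase c).card ≤ m := by rw [Finset.card_erase_of_mem hc]; omega
        refine Finset.sum_pos' (fun _ _ => Nat.zero_le _) ⟨c, hc, ?_⟩
        rw [if_pos hDc]
        exact (ih u (w.erase c) hfe).2.2
      by_cases h0 : u.card + w.card ≤ m ∧ tropDeg ωx ωy m u w = D
      · rw [if_pos h0]
        have := (ih u w h0.1).2.2
        positivity
      · rw [if_neg h0, zero_add]
        -- then `D = max Sx Sy`
        have hD' : D = max Sx Sy := by
          by_cases hfe : u.card + w.card ≤ m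
          · have h1 : D = max (tropDeg ωx ωy m u w) (max Sx Sy) := by rw [hDdef, if_pos hfe]
            have hne : tropDeg ωx ωy m u w ≠ D := fun heq => h0 ⟨hfe, heq⟩
            rcases le_total (tropDeg ωx ωy m u w) (max Sx Sy) with hc | hc
            · rw [h1, max_eq_right hc]
            · exfalso
              apply hne
              rw [h1, max_eq_left hc]
          · rw [hDdef, if_neg hfe, max_eq_right (Nat.zero_le _)]
        rcases le_total Sx Sy with hle | hle
        · -- `D = Sy`
          have hDy : D = Sy := by rw [hD', max_eq_right hle]
          by_cases hwne : w.Nonempty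
          · obtain ⟨c, hc, hcmax⟩ := Finset.exists_mem_eq_sup w hwne
              (fun c => ωy m c + tropDeg ωx ωy m u (w.erase c))
            have := gy c hc (by rw [hDy, hSy, hcmax])
            positivity
          · rw [Finset.not_nonempty_iff_eq_empty] at hwne
            have hSy0 : Sy = 0 := by rw [hSy, hwne, Finset.sup_empty, bot_eq_zero]
            by_cases hune : u.Nonempty
            · obtain ⟨a, ha⟩ := hune
              have hfa : ωx m a + tropDeg ωx ωy m (u.erase a) w = D := by
                apply le_antisymm
                · exact (Finset.le_sup (f := fun a => ωx m a + tropDeg ωx ωy m (u.erase a) w) ha).trans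
                    (hle.trans (by rw [hDy]))
                · rw [hDy, hSy0]; exact Nat.zero_le _
              have := gx a ha hfa
              positivity
            · exfalso
              rw [Finset.not_nonempty_iff_eq_empty] at hune
              apply h0
              have hSx0 : Sx = 0 := by rw [hSx, hune, Finset.sup_empty, bot_eq_zero]
              have hfe : u.card + w.card ≤ m := by rw [hune, hwne]; simp
              refine ⟨hfe, ?_⟩
              rw [hDdef, if_pos hfe, hSx0, hSy0]
              simp
        · -- `D = Sx`
          have hDx : D = Sx := by rw [hD', max_eq_left hle]
          by_cases hune : u.Nonempty
          · obtain ⟨a, ha, hamax⟩ := Finset.exists_mem_eq_sup u hune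
              (fun a => ωx m a + tropDeg ωx ωy m (u.erase a) w)
            have := gx a ha (by rw [hDx, hSx, hamax])
            positivity
          · rw [Finset.not_nonempty_iff_eq_empty] at hune
            have hSx0 : Sx = 0 := by rw [hSx, hune, Finset.sup_empty, bot_eq_zero]
            by_cases hwne : w.Nonempty
            · obtain ⟨c, hc⟩ := hwne
              have hfc : ωy m c + tropDeg ωx ωy m u (w.erase c) = D := by
                apply le_antisymm
                · exact (Finset.le_sup (f := fun c => ωy m c + tropDeg ωx ωy m u (w.erase c)) hc).trans
                    (hle.trans (by rw [hDx]))
                · rw [hDx, hSx0]; exact Nat.zero_le _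
              have := gy c hc hfc
              positivity
            · exfalso
              rw [Finset.not_nonempty_iff_eq_empty] at hwne
              apply h0
              have hSy0 : Sy = 0 := by rw [hSy, hwne, Finset.sup_empty, bot_eq_zero]
              have hfe : u.card + w.card ≤ m := by rw [hune, hwne]; simp
              refine ⟨hfe, ?_⟩
              rw [hDdef, if_pos hfe, hSx0, hSy0]
              simp
    exact ⟨hdegsum, hcoeff, hpos⟩

end

end Summit.ValiantsHypothesis.ValiantsHypothesis.Theorems.BarrierLever.ChowFactor
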